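import Summits.Langlands.Langlands.Theorems.ParityBlindBianchiTwoAdicBianchiProModularityLevelSqueezeDefs
import HarnessLib

/-!
# Route `ParityBlindBianchi`, crux `TwoAdicBianchiProModularityLevel` (stmt-Langlands-15110), line
# `dimension-squeeze`: the Artin point `x_σ` is a type-`θ` point

Registered sub-goals `squeeze_exists_artinTypePoint` and `squeeze_typeLocus_nontrivial` of the checked
skeleton `Cruxes/TwoAdicBianchiProModularityLevel/Lines/dimension_squeeze.lean` (v2): the first lemma of the
Galois half `stub_galoisDomain` (GAL) and the point through which the read-out `stub_zariskiReadout` (READ)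
factors.  Vocabulary (`Model`, `Model.datum`, `typeIdeal`, `typePoints`, `typeLocusIdeal`, `O2`) is the landed
Defs file `ParityBlindBianchiTwoAdicBianchiProModularityLevelSqueezeDefs.lean`; nothing is assumed.

* `Model.isDeformation_σ𝒪` — if `σ` is unramified at the good places, the integral model `σ_𝒪 : Γ_K → GL₂(𝒪)`
  is a type-`𝒟` lift of `σ̄` to the complete Noetherian local `𝒪`-algebra `(𝒪, 𝒪 ↠ k)` for Mazur's
  unramified-outside-`S` datum `M.datum` (`Θ = ∅`): open kernel ⇒ adically continuous, reduction `rfl`,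
  unramified outside the bad set, no polarisation [Maz, §20].
* `Model.typeIdeal_le_ker` — an `𝒪`-algebra point `φ : R → 𝒪` with `φ ∘ ρ^univ` strictly equivalent to `σ_𝒪`
  kills the type ideal `I_θ` (determinant, `σ`-minimality and inertial-trace generators are conjugation
  invariant).
* `squeeze_exists_artinTypePoint` — by the universal property of `R` such a `φ` exists, and `emb ∘ φ` is a
  type-`θ` point (`∈ typePoints`).
* `squeeze_typeLocus_nontrivial` — hence `typeLocusIdeal ≤ ker (emb ∘ φ) ≠ ⊤`: `R ⧸ I^θ ≠ 0`;
  `Model.typeLocusIdeal_eq_top_iff` — `I^θ = ⊤ ↔` there is no type point.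

References: B. Mazur, *An introduction to the deformation theory of Galois representations* (1997), §20
Prop. 2 [cite: Mazur1997Deformation, §20 Prop. 2]; M. Kisin, *Moduli of finite flat group schemes, and
modularity*, Ann. of Math. 170 (2009), §2.3 [cite: KisinModuli2009, §2.3].
-/

noncomputable section

set_option linter.dupNamespace false -- `Summit.Langlands.Langlands` is the mandated namespace (D-0017)

open scoped NumberField MatrixGroups
open IsDedekindDomain Field
open Literature.NumberTheory.GaloisRepresentations

namespace Summit.Langlands.Langlands.Cruxes.TwoAdicBianchiProModularityLevel.DimensionSqueeze

/-! ### The Artin point `x_σ` is a type-`θ` point -/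

namespace Model

variable {K : Type} [Field K] [NumberField K] {σ : FramedGaloisRep K (PadicAlgCl 2) 2} (M : Model σ)
  {S₀ : Finset ℕ} {h0 : (0 : ℕ) ∉ S₀} {h2 : 2 ∈ S₀}
  {hunr : ∀ v ∉ badSet K S₀, Deformation.IsUnramifiedAt v M.residual}

/-- **`σ_𝒪` is a type-`𝒟` lift of `σ̄` to `(𝒪, 𝒪 → k)`** as soon as `σ` is unramified at the good places:
open kernel ⇒ `𝔪_𝒪`-adically continuous; it reduces to `σ̄` by definition; it is unramified outside the
bad set (`Model.isUnramifiedAt_σ𝒪`); the polarisation is vacuous (`Θ = ∅`).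
[cite: Mazur1997Deformation, §20] -/
theorem isDeformation_σ𝒪
    (hσ : ∀ v : HeightOneSpectrum (𝓞 K), (∀ ℓ ∈ S₀, ((ℓ : ℕ) : 𝓞 K) ∉ v.asIdeal) → σ.IsUnramifiedAt v) :
    (M.datum S₀ h0 h2 hunr).IsDeformation (Algebra.ofId M.𝒪 M.k) M.σ𝒪 := by
  refine ⟨Deformation.isAdicContinuous_of_isOpen_ker M.isOpen_ker, rfl, fun v hv => ?_,
    fun c hc => False.elim hc⟩
  exact M.isUnramifiedAt_σ𝒪 (hσ v fun ℓ hℓ hℓv => hv fun hgood => hgood ℓ hℓ hℓv)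

/-- **A point of `R` at which `ρ^univ` becomes strictly equivalent to `σ_𝒪` kills the type ideal**:
determinants and traces are conjugation invariant (`Matrix.det_units_conj'`, `Matrix.trace_units_conj'`),
and `σ_𝒪(g) = 1` forces `φ(ρ^univ(g)) = P⁻¹ · 1 · P = 1`. [folklore] -/
theorem typeIdeal_le_ker (𝓡 : PolarizedDeformationRing (M.datum S₀ h0 h2 hunr)) (φ : 𝓡.R →ₐ[M.𝒪] M.𝒪)
    (hφ : Deformation.IsStrictEquiv (algebraMap M.𝒪 M.k)
      ((Matrix.GeneralLinearGroup.map (φ : 𝓡.R →+* M.𝒪)).comp 𝓡.ρ) M.σ𝒪) :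
    M.typeIdeal 𝓡 ≤ RingHom.ker (M.emb.comp (φ : 𝓡.R →+* M.𝒪)) := by
  obtain ⟨P, -, hP⟩ := hφ
  have hcomm : ∀ y : M.𝒪, (φ : 𝓡.R →+* M.𝒪) (algebraMap M.𝒪 𝓡.R y) = y := fun y => by simp
  have hval : ∀ g : absoluteGaloisGroup K,
      (φ : 𝓡.R →+* M.𝒪).mapMatrix ((𝓡.ρ g : GL (Fin 2) 𝓡.R) : Matrix (Fin 2) (Fin 2) 𝓡.R) =
        ((P⁻¹ : GL (Fin 2) M.𝒪) : Matrix (Fin 2) (Fin 2) M.𝒪) *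
          ((M.σ𝒪 g : GL (Fin 2) M.𝒪) : Matrix (Fin 2) (Fin 2) M.𝒪) *
            ((P : GL (Fin 2) M.𝒪) : Matrix (Fin 2) (Fin 2) M.𝒪) := by
    intro g
    have h1 : ((Matrix.GeneralLinearGroup.map (φ : 𝓡.R →+* M.𝒪)).comp 𝓡.ρ) g = P⁻¹ * M.σ𝒪 g * P := by
      rw [hP g]; group
    rw [MonoidHom.comp_apply] at h1
    ext i j
    rw [RingHom.mapMatrix_apply, Matrix.map_apply, ← Matrix.GeneralLinearGroup.map_apply, h1,
      Units.val_mul, Units.val_mul]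
  rw [typeIdeal, Ideal.span_le]
  intro x hx
  rw [SetLike.mem_coe, RingHom.mem_ker, RingHom.comp_apply]
  suffices h : (φ : 𝓡.R →+* M.𝒪) x = 0 by rw [h, map_zero]
  rcases hx with (⟨g, rfl⟩ | ⟨v, 𝔓, g, i, j, -, -, -, -, hσg, rfl⟩) | ⟨v, 𝔓, g, -, -, -, -, rfl⟩
  · rw [map_sub, RingHom.map_det, hval, Matrix.det_units_conj', hcomm, sub_self]
  · have h1 : (φ : 𝓡.R →+* M.𝒪).mapMatrix ((𝓡.ρ g : GL (Fin 2) 𝓡.R) : Matrix (Fin 2) (Fin 2) 𝓡.R) = 1 := by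
      rw [hval, hσg, Units.val_one, mul_one, Units.inv_mul]
    have hij := congrFun (congrFun h1 i) j
    rw [RingHom.mapMatrix_apply, Matrix.map_apply] at hij
    rw [map_sub, hij, Matrix.one_apply, Matrix.one_apply]
    split_ifs <;> simp
  · rw [map_sub, AddMonoidHom.map_trace (φ : 𝓡.R →+* M.𝒪), ← RingHom.mapMatrix_apply, hval,
      Matrix.trace_units_conj', hcomm, sub_self]

/-- `typeLocusIdeal = ⊤` exactly when there is no type-`θ` point (the empty locus). [folklore] -/
theorem typeLocusIdeal_eq_top_iff (𝓡 : PolarizedDeformationRing (M.datum S₀ h0 h2 hunr)) :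
    M.typeLocusIdeal 𝓡 = ⊤ ↔ M.typePoints 𝓡 = ∅ := by
  constructor
  · intro h
    refine Set.eq_empty_iff_forall_notMem.mpr fun φ hφ => ?_
    have hle : M.typeLocusIdeal 𝓡 ≤ RingHom.ker φ := iInf₂_le φ hφ
    rw [h, top_le_iff] at hle
    exact RingHom.ker_ne_top φ hle
  · intro h
    rw [typeLocusIdeal, h]
    simp

end Model

/-- REGISTERED SUB-GOAL `squeeze_exists_artinTypePoint` (first lemma of `stub_galoisDomain`, also the
point through which `stub_zariskiReadout` factors): **the Artin point `x_σ` exists and is a type-`θ`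
point.**  `σ_𝒪` is a type-`𝒟` lift of `σ̄` to the complete Noetherian local `𝒪`-algebra `(𝒪, 𝒪 ↠ k)`
(`Model.isDeformation_σ𝒪`), so the universal property of `R` yields `φ : R →ₐ[𝒪] 𝒪` with `φ ∘ ρ^univ`
strictly equivalent to `σ_𝒪`; then `emb ∘ φ` restricts to `emb` on `𝒪` (`AlgHom.commutes`) and kills the
type ideal (`Model.typeIdeal_le_ker`). [cite: Mazur1997Deformation, §20 Prop. 2] -/
theorem squeeze_exists_artinTypePoint : ∀ (K : Type) [Field K] [NumberField K]
    (σ : FramedGaloisRep K (PadicAlgCl 2) 2) (S₀ : Finset ℕ) (h0 : (0 : ℕ) ∉ S₀) (h2 : 2 ∈ S₀),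
    (∀ v : HeightOneSpectrum (𝓞 K), (∀ ℓ ∈ S₀, ((ℓ : ℕ) : 𝓞 K) ∉ v.asIdeal) → σ.IsUnramifiedAt v) →
    ∀ (M : Model σ) (hunr : ∀ v ∉ badSet K S₀, Deformation.IsUnramifiedAt v M.residual)
      (𝓡 : PolarizedDeformationRing (M.datum S₀ h0 h2 hunr)),
    ∃ φ : 𝓡.R →ₐ[M.𝒪] M.𝒪,
      Deformation.IsStrictEquiv (algebraMap M.𝒪 M.k)
        ((Matrix.GeneralLinearGroup.map (φ : 𝓡.R →+* M.𝒪)).comp 𝓡.ρ) M.σ𝒪 ∧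
      M.emb.comp (φ : 𝓡.R →+* M.𝒪) ∈ M.typePoints 𝓡 := by
  intro K _ _ σ S₀ h0 h2 hσ M hunr 𝓡
  obtain ⟨φ, hφ, -⟩ :=
    𝓡.universal M.𝒪 (Algebra.ofId M.𝒪 M.k) M.residue_surjective M.σ𝒪 (M.isDeformation_σ𝒪 hσ)
  exact ⟨φ, hφ, RingHom.ext fun y => by simp, M.typeIdeal_le_ker 𝓡 φ hφ⟩

/-- REGISTERED SUB-GOAL `squeeze_typeLocus_nontrivial`: under the hypotheses of
`squeeze_exists_artinTypePoint`, **the type-`θ` locus is non-empty**, `R ⧸ I^θ ≠ 0`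
(`I^θ ≤ ker x_σ ≠ ⊤`). [folklore] -/
theorem squeeze_typeLocus_nontrivial : ∀ (K : Type) [Field K] [NumberField K]
    (σ : FramedGaloisRep K (PadicAlgCl 2) 2) (S₀ : Finset ℕ) (h0 : (0 : ℕ) ∉ S₀) (h2 : 2 ∈ S₀),
    (∀ v : HeightOneSpectrum (𝓞 K), (∀ ℓ ∈ S₀, ((ℓ : ℕ) : 𝓞 K) ∉ v.asIdeal) → σ.IsUnramifiedAt v) →
    ∀ (M : Model σ) (hunr : ∀ v ∉ badSet K S₀, Deformation.IsUnramifiedAt v M.residual)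
      (𝓡 : PolarizedDeformationRing (M.datum S₀ h0 h2 hunr)),
    Nontrivial (𝓡.R ⧸ M.typeLocusIdeal 𝓡) := by
  intro K _ _ σ S₀ h0 h2 hσ M hunr 𝓡
  obtain ⟨φ, -, hφ⟩ := squeeze_exists_artinTypePoint K σ S₀ h0 h2 hσ M hunr 𝓡
  refine Ideal.Quotient.nontrivial_iff.mpr fun htop => ?_
  have hle : M.typeLocusIdeal 𝓡 ≤ RingHom.ker (M.emb.comp (φ : 𝓡.R →+* M.𝒪)) := iInf₂_le _ hφ
  rw [htop, top_le_iff] at hle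
  exact RingHom.ker_ne_top _ hle

end Summit.Langlands.Langlands.Cruxes.TwoAdicBianchiProModularityLevel.DimensionSqueeze

end
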